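import Summits.ResolutionOfSingularities.ResolutionOfSingularities.Theorems.EquisingularLiftEquisingularLiftNatCarrierDeltaComapFrame
import Literature.AlgebraicGeometry.Resolution.BlowupStalkCharts
import Literature.AlgebraicGeometry.Resolution.AffineBlowupUnique
import Literature.AlgebraicGeometry.Resolution.AlterationsNodalBoundary
import Literature.AlgebraicGeometry.Resolution.ComponentGluing
import Literature.AlgebraicGeometry.Resolution.StalkIdealLemmas
import HarnessLib

/-!
# [OURS · L1 W4.5(b) · EL♮(3)] OFF THE SHADOW: THE SHADOW EQUATION IS A NONZERODIVISOR ON THE REDUCED ČECH CENTRE TRACE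
# (geometric input of the (N3)/(N3′) dischargers of TOWER₄'s S6 `hCech`: `closure (Z ∖ K) = Z` ⟹ `f̄` regular on `𝒪_{G,p} ⧸ 𝓘⟨Z⟩_p`,
# and upstairs `f` regular on `𝒪_{X,jG p} ⧸ (𝒞_{jG p} + (ϖ))`)

Crux chain w45b (cell `res-hironaka`, slot W4.5(b)), working crux **EL♮** = stmt-ResolutionOfSingularities-20038, child **EL♮(3)** =
stmt-ResolutionOfSingularities-20148, route EquisingularLift, line `sections`; registered stub `stub_elnat_coneTowerPointResolution` @ `ReachTower₄`,
stand-in S6 `hCech`, sub-stand-ins (N3) `hShadow` / (N3′) `hShadowOld` of res-D-pv-057's `Tower.hCech_of₃`. Written by res-L1-w45b-stub-2 g8.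
HONEST FRAMING: OURS; NOT a statement of any manuscript; AI-written, weaker than expert review. No `sorry`; standard axioms; DEF-FREE.
`--supports stmt-ResolutionOfSingularities-20148 --as helper`.

WHAT. The one GEOMETRIC input of res-L1-w45b-lead-2's route for (N3)/(N3′) (STATUS 2026-08-27T21:14:43Z: «the Čech centre MAY meet `V(𝒦)`»):
the side condition «`closure (Z ∖ closure K) = Z`» of the Čech disjunct of `TowerRound₃` says that the shadow `K` contains NO irreducible component of
the (reduced, possibly reducible or nodal) centre trace `Z`; algebraically, at every point `p`:
* `exists_isOpen_inter_subset_closure_of_forall_specializes` — topology: in a Noetherian quasi-sober space, a point `ζ ∈ Z` that is MAXIMAL in the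
  closed set `Z` (no other point of `Z` generalises to it) has an open neighbourhood `U` with `U ∩ Z ⊆ closure {ζ}` (finite decomposition of `Z` into
  irreducible closed pieces, generic points);
* **`mem_stalkIdeal_vanishingIdeal_of_mul_mem`** — if `Z ⊆ closure (Z ∖ K)` and the stalk `𝓘⟨K⟩_p` lies in `(g)`, then `g` is a NONZERODIVISOR modulo
  `𝓘⟨Z⟩_p`: a minimal prime of the radical ideal `𝓘⟨Z⟩_p` missing `a` but containing `g` is a point `ζ` of `Z ∩ K` generalising `p` and maximal in `Z`
  (`Spec 𝒪_{G,p} → G` is an embedding onto the generalisations of `p`, Mathlib `Scheme.range_fromSpecStalk`), so some neighbourhood of `ζ` meets `Z` inside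
  `closure {ζ} ⊆ K` — impossible, `ζ ∈ closure (Z ∖ K)`;
* **`mem_sup_span_of_mul_mem_of_model`** — the UPSTAIRS form in a model square `jG : G ⟶ X` over `Spec θ` (`θ : O ↠ k`, `O` a DVR with uniformiser
  `ϖ`): for ideal sheaves `𝒞`, `𝒦` on `X` with `(𝒞·𝒪_G)_p = 𝓘⟨Z⟩_p`, `(𝒦·𝒪_G)_p = 𝓘⟨K⟩_p` (stalk equalities — so the localized trace currency (k-ii-loc)
  of `Tower.Shadow₃` is served as well) and `𝒦_x = (f)` at `x = jG p`: `f · a ∈ 𝒞_x + (ϖ_x) ⟹ a ∈ 𝒞_x + (ϖ_x)` — `f̄` is a nonzerodivisor of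
  `𝒪_{X,x} ⧸ (𝒞_x + (ϖ))` (`jG^♯_p` is onto with kernel `(ϖ_x)`, tree `stalkMap_model_surjective` / `ker_stalkMap_model_le` / `stalkMap_model_varpi`).

References (index only): [cite: StacksProject, Tag 0052] (Noetherian spaces: finite irreducible decomposition); [cite: Matsumura1987, §6] (minimal primes
of reduced rings consist of zero divisors' complements); tree …NatTowerExceptionalDense p564222 (the `fromSpecStalk` support dictionary `hfmem`, copied),
…NatCarrierDeltaComapFrame (model-square stalk lemmas).
-/

set_option linter.dupNamespace false -- mandated namespace `Summit.<Summit>.<Problem>` of this single-conjunct summit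

noncomputable section

open CategoryTheory AlgebraicGeometry TopologicalSpace Topology IsLocalRing
open Literature.AlgebraicGeometry.Resolution
open AlgebraicGeometry.Scheme.IdealSheafData

namespace Summit.ResolutionOfSingularities.ResolutionOfSingularities.Cruxes.EquisingularLiftNat.Sections.CechShadow

universe u

/-! ## Topology: a maximal point of a closed set in a Noetherian sober space -/

/-- **A maximal point of a closed subset of a Noetherian quasi-sober space is generic on a neighbourhood**: if `ζ ∈ Z` and no other point of the
closed set `Z` specialises to `ζ`, there is an open `U ∋ ζ` with `U ∩ Z ⊆ closure {ζ}`. [cite: StacksProject, Tag 0052] -/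
theorem exists_isOpen_inter_subset_closure_of_forall_specializes {α : Type u} [TopologicalSpace α] [NoetherianSpace α]
    [QuasiSober α] {Z : Set α} (hZ : IsClosed Z) {ζ : α} (hmax : ∀ z ∈ Z, z ⤳ ζ → z = ζ) :
    ∃ U : Set α, IsOpen U ∧ ζ ∈ U ∧ U ∩ Z ⊆ closure {ζ} := by
  classical
  obtain ⟨S, hSfin, hScl, hSirr, hZS⟩ := NoetherianSpace.exists_finite_set_isClosed_irreducible hZ
  -- every irreducible closed piece through `ζ` is `closure {ζ}`
  have hpiece : ∀ t ∈ S, ζ ∈ t → t = closure {ζ} := by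
    intro t ht hζt
    have hgen := (hSirr t ht).isGenericPoint_genericPoint (hScl t ht)
    have hξZ : (hSirr t ht).genericPoint ∈ Z := by
      rw [hZS]; exact Set.mem_sUnion_of_mem hgen.mem ht
    have hξ : (hSirr t ht).genericPoint = ζ := hmax _ hξZ (hgen.specializes hζt)
    rw [← hgen.def, hξ]
  refine ⟨(⋃ t ∈ {t ∈ S | ζ ∉ t}, t)ᶜ, ?_, ?_, ?_⟩
  · rw [isOpen_compl_iff]
    exact (hSfin.subset (Set.sep_subset _ _)).isClosed_biUnion fun t ht => hScl t ht.1
  · rw [Set.mem_compl_iff, Set.mem_iUnion₂]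
    rintro ⟨t, ht, hζt⟩
    exact ht.2 hζt
  · rintro z ⟨hzU, hzZ⟩
    rw [hZS] at hzZ
    obtain ⟨t, ht, hzt⟩ := Set.mem_sUnion.mp hzZ
    by_cases hζt : ζ ∈ t
    · rw [← hpiece t ht hζt]; exact hzt
    · exact absurd (Set.mem_iUnion₂.mpr ⟨t, ⟨ht, hζt⟩, hzt⟩) hzU

/-! ## Downstairs: `f̄` is a nonzerodivisor modulo `𝓘⟨Z⟩_p` -/

/-- **Off the shadow, the shadow equation is a nonzerodivisor on the reduced centre trace.** Let `G` be a scheme with Noetherian underlying space,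
`Z, K ⊆ G` closed with `Z ⊆ closure (Z ∖ K)` (no component of `Z` lies in `K`), `p ∈ G`, and `g ∈ 𝒪_{G,p}` with `𝓘⟨K⟩_p ⊆ (g)` (e.g. a generator
of the reduced ideal of `K` at `p`). Then `g · a ∈ 𝓘⟨Z⟩_p ⟹ a ∈ 𝓘⟨Z⟩_p`. [cite: Matsumura1987, §6] [OURS · L1 W4.5b] -/
theorem mem_stalkIdeal_vanishingIdeal_of_mul_mem {G : Scheme.{u}} [NoetherianSpace G] (Z K : Set G) (hZ : IsClosed Z) (hK : IsClosed K)
    (hoff : Z ⊆ closure (Z \ K)) (p : G) (g : G.presheaf.stalk p)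
    (hg : stalkIdeal (vanishingIdeal (⟨K, hK⟩ : Closeds G)) p ≤ Ideal.span {g}) (a : G.presheaf.stalk p)
    (h : g * a ∈ stalkIdeal (vanishingIdeal (⟨Z, hZ⟩ : Closeds G)) p) :
    a ∈ stalkIdeal (vanishingIdeal (⟨Z, hZ⟩ : Closeds G)) p := by
  classical
  set J := stalkIdeal (vanishingIdeal (⟨Z, hZ⟩ : Closeds G)) p with hJ
  by_contra ha
  -- `J` is radical, so `a` misses one of its minimal primes `𝔮`, which then contains `g`
  haveI := ComponentGluing.isReduced_subscheme_vanishingIdeal (⟨Z, hZ⟩ : Closeds G)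
  have hJrad : J.IsRadical := isRadical_stalkIdeal_of_isReduced_subscheme (vanishingIdeal (⟨Z, hZ⟩ : Closeds G)) p
  obtain ⟨𝔮, h𝔮min, ha𝔮⟩ : ∃ 𝔮 ∈ J.minimalPrimes, a ∉ 𝔮 := by
    by_contra hall
    apply ha
    rw [← hJrad.radical, ← Ideal.sInf_minimalPrimes, Submodule.mem_sInf]
    intro 𝔮 h𝔮
    by_contra hnot
    exact hall ⟨𝔮, h𝔮, hnot⟩
  have h𝔮p : 𝔮.IsPrime := h𝔮min.1.1
  have hJ𝔮 : J ≤ 𝔮 := h𝔮min.1.2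
  have hg𝔮 : g ∈ 𝔮 := ((h𝔮p.mem_or_mem (hJ𝔮 h)).resolve_right ha𝔮)
  -- the point `ζ` of `Spec 𝒪_{G,p} → G` at `𝔮`; support dictionary (adapted from …NatTowerExceptionalDense `hfmem`)
  let φ := G.fromSpecStalk p
  have hfmem : ∀ (W : G.IdealSheafData) (𝔭 : PrimeSpectrum (G.presheaf.stalk p)),
      φ 𝔭 ∈ W.support ↔ stalkIdeal W p ≤ 𝔭.asIdeal := by
    intro W 𝔭
    have h1 : φ 𝔭 ∈ W.support ↔ 𝔭 ∈ ((W.comap φ).support : Set (Spec (G.presheaf.stalk p))) := by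
      rw [Scheme.IdealSheafData.support_comap]; rfl
    rw [h1, comap_fromSpecStalk_eq_affineBlowupIdealSheaf, affineBlowup.support_idealSheaf]
    change ((stalkIdeal W p : Set (G.presheaf.stalk p)) ⊆ (𝔭.asIdeal : Set (G.presheaf.stalk p))) ↔ _
    rw [SetLike.coe_subset_coe]
  set ζ : G := φ ⟨𝔮, h𝔮p⟩ with hζdef
  have hsuppZ : ((vanishingIdeal (⟨Z, hZ⟩ : Closeds G)).support : Set G) = Z := Scheme.IdealSheafData.coe_support_vanishingIdeal _
  have hsuppK : ((vanishingIdeal (⟨K, hK⟩ : Closeds G)).support : Set G) = K := Scheme.IdealSheafData.coe_support_vanishingIdeal _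
  have hζZ : ζ ∈ Z := by
    have h1 : ζ ∈ ((vanishingIdeal (⟨Z, hZ⟩ : Closeds G)).support : Set G) := (hfmem _ ⟨𝔮, h𝔮p⟩).mpr hJ𝔮
    rwa [hsuppZ] at h1
  have hζK : ζ ∈ K := by
    have h1 : ζ ∈ ((vanishingIdeal (⟨K, hK⟩ : Closeds G)).support : Set G) :=
      (hfmem _ ⟨𝔮, h𝔮p⟩).mpr (hg.trans ((Ideal.span_singleton_le_iff_mem _).mpr hg𝔮))
    rwa [hsuppK] at h1
  have hζp : ζ ⤳ p := by
    have h1 : ζ ∈ Set.range φ := ⟨_, rfl⟩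
    rw [Scheme.range_fromSpecStalk] at h1
    exact h1
  -- `ζ` is maximal in `Z`: a point of `Z` generalising `ζ` is a prime of `𝒪_{G,p}` between `J` and `𝔮`
  have hmax : ∀ z ∈ Z, z ⤳ ζ → z = ζ := by
    intro z hz hzζ
    obtain ⟨𝔮', rfl⟩ : z ∈ Set.range φ := by
      rw [Scheme.range_fromSpecStalk]; exact hzζ.trans hζp
    have h1 : 𝔮' ⤳ (⟨𝔮, h𝔮p⟩ : PrimeSpectrum (G.presheaf.stalk p)) := (φ.isEmbedding.isInducing.specializes_iff).mp hzζ
    have h2 : 𝔮'.asIdeal ≤ 𝔮 := (PrimeSpectrum.le_iff_specializes _ _).mpr h1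
    have h3 : J ≤ 𝔮'.asIdeal := (hfmem _ 𝔮').mp (show φ 𝔮' ∈ ((vanishingIdeal (⟨Z, hZ⟩ : Closeds G)).support : Set G) by
      rw [hsuppZ]; exact hz)
    have h4 : 𝔮 ≤ 𝔮'.asIdeal := h𝔮min.2 ⟨𝔮'.2, h3⟩ h2
    have h5 : 𝔮' = ⟨𝔮, h𝔮p⟩ := PrimeSpectrum.ext (le_antisymm h2 h4)
    rw [h5]
  obtain ⟨U, hU, hζU, hUZ⟩ := exists_isOpen_inter_subset_closure_of_forall_specializes hZ hmax
  obtain ⟨z, hzU, hzZ, hzK⟩ := mem_closure_iff.mp (hoff hζZ) U hU hζU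
  exact hzK ((closure_minimal (Set.singleton_subset_iff.mpr hζK) hK) (hUZ ⟨hzU, hzZ⟩))

/-! ## Upstairs: `f` is a nonzerodivisor modulo `𝒞_x + (ϖ)` -/

/-- **The upstairs form in a model square.** `jG : G ⟶ X` the special fibre of `r : X → Spec O` (`θ : O ↠ k`, `O` a DVR with uniformiser `ϖ`),
`𝒞`, `𝒦` ideal sheaves on `X` whose traces AT THE STALK `p` are `𝓘⟨Z⟩_p` and `𝓘⟨K⟩_p` (`Z ⊆ closure (Z ∖ K)`, `G` Noetherian as a space), and
`𝒦_{jG p} = (f)`. Then `f` is a nonzerodivisor modulo `𝒞_{jG p} + (ϖ_{jG p})`. [OURS · L1 W4.5b] geometric input of (N3)/(N3′). -/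
theorem mem_sup_span_of_mul_mem_of_model (O : Type) [CommRing O] [IsDomain O] [IsDiscreteValuationRing O] (k : Type) [Field k]
    (θ : O →+* k) (hθ : Function.Surjective θ) {X G : Scheme.{0}} [NoetherianSpace G] (r : X ⟶ Spec (.of O))
    (jG : G ⟶ X) (tG : G ⟶ Spec (.of k)) (hsq : IsPullback jG tG r (Spec.map (CommRingCat.ofHom θ)))
    (ϖ : O) (hϖ : Irreducible ϖ) (𝒞 𝒦 : X.IdealSheafData) (Z K : Set G) (hZ : IsClosed Z) (hK : IsClosed K)
    (hoff : Z ⊆ closure (Z \ K)) (p : G)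
    (h𝒞 : stalkIdeal (𝒞.comap jG) p = stalkIdeal (vanishingIdeal (⟨Z, hZ⟩ : Closeds G)) p)
    (h𝒦 : stalkIdeal (𝒦.comap jG) p = stalkIdeal (vanishingIdeal (⟨K, hK⟩ : Closeds G)) p)
    (f : X.presheaf.stalk (jG p)) (hf : stalkIdeal 𝒦 (jG p) = Ideal.span {f}) (a : X.presheaf.stalk (jG p))
    (ha : f * a ∈ stalkIdeal 𝒞 (jG p) ⊔ Ideal.span {(X.presheaf.Γgerm (jG p)).hom (r.appTop.hom ((Scheme.ΓSpecIso (.of O)).inv.hom ϖ))}) :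
    a ∈ stalkIdeal 𝒞 (jG p) ⊔ Ideal.span {(X.presheaf.Γgerm (jG p)).hom (r.appTop.hom ((Scheme.ΓSpecIso (.of O)).inv.hom ϖ))} := by
  set ϖx := (X.presheaf.Γgerm (jG p)).hom (r.appTop.hom ((Scheme.ΓSpecIso (.of O)).inv.hom ϖ)) with hϖx
  set ψ := (jG.stalkMap p).hom with hψ
  have hsurj : Function.Surjective ψ := stalkMap_model_surjective θ hθ r jG tG hsq p
  have hker : RingHom.ker ψ ≤ Ideal.span {ϖx} := ker_stalkMap_model_le O k θ hθ r jG tG hsq p ϖ hϖ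
  have hϖ0 : ψ ϖx = 0 := stalkMap_model_varpi θ hθ r jG tG hsq p ϖ (hϖ.maximalIdeal_eq ▸ Ideal.mem_span_singleton_self ϖ)
  -- `ψ(𝒞_x + (ϖ_x)) = 𝓘⟨Z⟩_p` and its preimage is `𝒞_x + (ϖ_x)`
  have hmapZ : (stalkIdeal 𝒞 (jG p) ⊔ Ideal.span {ϖx}).map ψ = stalkIdeal (vanishingIdeal (⟨Z, hZ⟩ : Closeds G)) p := by
    rw [Ideal.map_sup, Ideal.map_span, Set.image_singleton, hϖ0, Ideal.span_singleton_eq_bot.mpr rfl, sup_bot_eq, ← h𝒞, hψ,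
      stalkIdeal_comap_eq_map_stalkMap]
  have hcomapZ : (stalkIdeal (vanishingIdeal (⟨Z, hZ⟩ : Closeds G)) p).comap ψ = stalkIdeal 𝒞 (jG p) ⊔ Ideal.span {ϖx} := by
    rw [← hmapZ, Ideal.comap_map_of_surjective _ hsurj, ← RingHom.ker_eq_comap_bot]
    exact sup_eq_left.mpr (hker.trans le_sup_right)
  -- `ψ(f)` generates `𝓘⟨K⟩_p`
  have hgK : stalkIdeal (vanishingIdeal (⟨K, hK⟩ : Closeds G)) p ≤ Ideal.span {ψ f} := by
    rw [← h𝒦, hψ, stalkIdeal_comap_eq_map_stalkMap, hf, Ideal.map_span, Set.image_singleton]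
  -- downstairs
  have h1 : ψ f * ψ a ∈ stalkIdeal (vanishingIdeal (⟨Z, hZ⟩ : Closeds G)) p := by
    rw [← map_mul, ← hmapZ]
    exact Ideal.mem_map_of_mem ψ ha
  have h2 := mem_stalkIdeal_vanishingIdeal_of_mul_mem Z K hZ hK hoff p (ψ f) hgK (ψ a) h1
  rw [← hcomapZ, Ideal.mem_comap]
  exact h2

end Summit.ResolutionOfSingularities.ResolutionOfSingularities.Cruxes.EquisingularLiftNat.Sections.CechShadow

end
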